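import Literature.ComputerArithmetic.Shewchuk1997.Compress
import Mathlib.Tactic.Linarith
import Mathlib.Tactic.Positivity
import Mathlib.Tactic.Ring
import Mathlib.Tactic.NormNum

/-!
# COMPRESS is not idempotent — the remaining precision `p = 2` (new work)

New work of the certified-arithmetic venture (ENGINES group: shared numerical engines serving
client cells; rigour lives in the verifiers; every published number belongs to a client cell's
ledger, not to the engines group).

`CompressNotIdempotent` exhibits, for every precision `p ≥ 3` under round-to-nearest-even, a
three-component nonoverlapping expansion on which a second pass of COMPRESS [Shewchuk1997, §2.7
Theorem 23] still shortens the output.  Its family degenerates at `p = 2` (the bottom component `3`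
is no longer below `2^p`).  THIS FILE closes the gap with a four-component witness at `p = 2`
(gradual underflow, `emin ≤ 0`):

  `COMPRESS⟨1, 4, 8, 32⟩ = ⟨1, −4, 48⟩`,   `COMPRESS⟨1, −4, 48⟩ = ⟨−3, 48⟩`

(`compress_p2_once`, `compress_p2_twice`, `compress_not_idempotent_prec_two`).  The first pass
meets ONE tie, `RN_e(32 + 8) = RN_e(40) = 32` (even significand `2` against `48 = 3·16`); the other
roundings are `RN_e(13) = 12`, `RN_e(44) = 48`, `RN_e(45) = 48` and exact float sums.  An integer
model of the printed algorithm finds no zero-free THREE-component witness at `p = 2` with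
components below `2^9` (a search, not a theorem); four components are used here.
HONEST FRAMING: Theorem 23 claims neither idempotence nor minimality of the output; this is a
property of the printed algorithm under the printed tie rule, kernel-checked on explicit data.
-/

namespace Summit.Ventures.CertifiedArithmetic.Expansions

open Literature.ComputerArithmetic.JeannerodRump2018
open Literature.ComputerArithmetic.BoldoJeannerodMelquiondMuller2023 hiding twoSum twoSum_fst
open Literature.ComputerArithmetic.Shewchuk1997

variable {emin : ℤ}

/-! ### Evaluating `roundTiesEven 2 emin` -/

/-- `2^m ≤ |t| < 2^(m+1)`, `emin ≤ m − p + 1` ⟹ `ulp(t) = 2^(m−p+1)`.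
[cite: BoldoEtAl2023, §2.1] -/
private theorem ulp_eq_of_binade' {p : ℕ} {t : ℚ} {m : ℤ} (hm : emin ≤ m - p + 1)
    (h1 : (2 : ℚ) ^ m ≤ |t|) (h2 : |t| < (2 : ℚ) ^ (m + 1)) :
    ulp p emin t = (2 : ℚ) ^ (m - p + 1) := by
  have hpos : 0 < |t| := lt_of_lt_of_le (zpow_pos (by norm_num) _) h1
  have ht0 : t ≠ 0 := abs_pos.mp hpos
  have hlo : m ≤ Int.log 2 |t| :=
    (Int.zpow_le_iff_le_log (b := 2) (by norm_num) hpos).mp (by exact_mod_cast h1)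
  have hhi : Int.log 2 |t| < m + 1 :=
    (Int.lt_zpow_iff_log_lt (b := 2) (by norm_num) hpos).mp (by exact_mod_cast h2)
  have hlog : Int.log 2 |t| = m := le_antisymm (by omega) hlo
  rw [ulp_of_ne_zero ht0, hlog, max_eq_right hm]

/-- `t = (N + r)·ulp(t)` with `0 ≤ r < 1` gives `⌊t/ulp(t)⌋ = N`.
[cite: BoldoEtAl2023, §2.2] -/
private theorem rne_floor' {p : ℕ} {t U r : ℚ} {N : ℤ} (hU : ulp p emin t = U) (hUpos : 0 < U)
    (ht : t = ((N : ℚ) + r) * U) (hr0 : 0 ≤ r) (hr1 : r < 1) : ⌊t / ulp p emin t⌋ = N := by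
  rw [hU, Int.floor_eq_iff, ht, mul_div_assoc, div_self hUpos.ne', mul_one]
  constructor <;> linarith

/-- `RN_e` below the midpoint: `r < ½` ⟹ `RN_e(t) = N·ulp(t)`. [cite: BoldoEtAl2023, §2.2] -/
private theorem rne_down' {p : ℕ} {t U r : ℚ} {N : ℤ} (hU : ulp p emin t = U) (hUpos : 0 < U)
    (ht : t = ((N : ℚ) + r) * U) (hr0 : 0 ≤ r) (hr1 : r < 1) (hr : r < 1 / 2) :
    roundTiesEven p emin t = (N : ℚ) * U := by
  have hfl := rne_floor' hU hUpos ht hr0 hr1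
  have e1 : t - (N : ℚ) * U = r * U := by rw [ht]; ring
  have e2 : ((N : ℚ) + 1) * U - t = (1 - r) * U := by rw [ht]; ring
  have hlt : r * U < (1 - r) * U := mul_lt_mul_of_pos_right (by linarith) hUpos
  unfold roundTiesEven
  rw [hfl, hU, e1, e2, if_pos hlt]

/-- `RN_e` above the midpoint: `r > ½` ⟹ `RN_e(t) = (N+1)·ulp(t)`.
[cite: BoldoEtAl2023, §2.2] -/
private theorem rne_up' {p : ℕ} {t U r : ℚ} {N : ℤ} (hU : ulp p emin t = U) (hUpos : 0 < U)
    (ht : t = ((N : ℚ) + r) * U) (hr0 : 0 ≤ r) (hr1 : r < 1) (hr : 1 / 2 < r) :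
    roundTiesEven p emin t = ((N : ℚ) + 1) * U := by
  have hfl := rne_floor' hU hUpos ht hr0 hr1
  have e1 : t - (N : ℚ) * U = r * U := by rw [ht]; ring
  have e2 : ((N : ℚ) + 1) * U - t = (1 - r) * U := by rw [ht]; ring
  have hgt : (1 - r) * U < r * U := mul_lt_mul_of_pos_right (by linarith) hUpos
  unfold roundTiesEven
  rw [hfl, hU, e1, e2, if_neg (not_lt.mpr hgt.le), if_pos hgt]

/-- `RN_e` AT the midpoint, even `N`: `RN_e(t) = N·ulp(t)` — the printed tie rule.
[cite: BoldoEtAl2023, §2.2 (p. 212, "the one whose integral significand is even")] -/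
private theorem rne_tie_even' {p : ℕ} {t U : ℚ} {N : ℤ} (hU : ulp p emin t = U)
    (hUpos : 0 < U) (ht : t = ((N : ℚ) + 1 / 2) * U) (hN : Even N) :
    roundTiesEven p emin t = (N : ℚ) * U := by
  have hfl := rne_floor' hU hUpos ht (by norm_num) (by norm_num)
  have e1 : t - (N : ℚ) * U = 1 / 2 * U := by rw [ht]; ring
  have e2 : ((N : ℚ) + 1) * U - t = 1 / 2 * U := by rw [ht]; ring
  unfold roundTiesEven
  rw [hfl, hU, e1, e2, if_neg (lt_irrefl _), if_neg (lt_irrefl _), if_pos hN]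

/-- FAST-TWO-SUM evaluated: floats `|b| ≤ |a|`, `fl(a + b) = s` ⟹ `(s, a + b − s)`.
[cite: Shewchuk1997, §2.3 Theorem 6] -/
private theorem f2s_eq' {p : ℕ} {fl : ℚ → ℚ} (hp : 1 ≤ p) (hfl : IsRoundNearest p emin fl)
    {a b s : ℚ} (ha : IsFloat p emin a) (hb : IsFloat p emin b) (hab : |b| ≤ |a|)
    (hs : fl (a + b) = s) : fastTwoSum fl a b = (s, a + b - s) := by
  obtain ⟨h1, -, h2, -⟩ := fastTwoSum_exact hp hfl ha hb hab
  exact Prod.ext (by rw [h1, hs]) (by rw [h2, hs])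

/-! ### The four roundings at `p = 2` -/

/-- THE TIE: `RN_e(40) = 32` at `p = 2` (`ulp = 16`; neighbours `32 = 2·16` even, `48 = 3·16`
odd).
[cite: BoldoEtAl2023, §2.2; Shewchuk1997, §2.7 p. 332] -/
theorem p2_rne_40 (he : emin ≤ 0) : roundTiesEven 2 emin 40 = 32 := by
  have hU : ulp 2 emin (40 : ℚ) = 16 := by
    rw [ulp_eq_of_binade' (p := 2) (m := 5) (by omega) (by norm_num) (by norm_num)]; norm_num
  rw [rne_tie_even' hU (by norm_num) (N := 2) (by norm_num) even_two]; norm_num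

/-- `RN_e(13) = 12` at `p = 2` (`ulp = 4`, below the midpoint `14`). [cite: BoldoEtAl2023, §2.2] -/
theorem p2_rne_13 (he : emin ≤ 0) : roundTiesEven 2 emin 13 = 12 := by
  have hU : ulp 2 emin (13 : ℚ) = 4 := by
    rw [ulp_eq_of_binade' (p := 2) (m := 3) (by omega) (by norm_num) (by norm_num)]; norm_num
  rw [rne_down' hU (by norm_num) (N := 3) (r := 1 / 4) (by norm_num) (by norm_num) (by norm_num)
    (by norm_num)]
  norm_num

/-- `RN_e(44) = 48` at `p = 2` (`ulp = 16`, above the midpoint `40`).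
[cite: BoldoEtAl2023, §2.2] -/
theorem p2_rne_44 (he : emin ≤ 0) : roundTiesEven 2 emin 44 = 48 := by
  have hU : ulp 2 emin (44 : ℚ) = 16 := by
    rw [ulp_eq_of_binade' (p := 2) (m := 5) (by omega) (by norm_num) (by norm_num)]; norm_num
  rw [rne_up' hU (by norm_num) (N := 2) (r := 3 / 4) (by norm_num) (by norm_num) (by norm_num)
    (by norm_num)]
  norm_num

/-- `RN_e(45) = 48` at `p = 2` (`ulp = 16`, above the midpoint `40`).
[cite: BoldoEtAl2023, §2.2] -/
theorem p2_rne_45 (he : emin ≤ 0) : roundTiesEven 2 emin 45 = 48 := by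
  have hU : ulp 2 emin (45 : ℚ) = 16 := by
    rw [ulp_eq_of_binade' (p := 2) (m := 5) (by omega) (by norm_num) (by norm_num)]; norm_num
  rw [rne_up' hU (by norm_num) (N := 2) (r := 13 / 16) (by norm_num) (by norm_num) (by norm_num)
    (by norm_num)]
  norm_num

/-- The floats of the witness at `p = 2` (`emin ≤ 0`): `1, 4, 8, 32, 12, 48, −4, −3`.
[cite: JeannerodRump2018, §1 (the set F)] -/
theorem p2_isFloat (he : emin ≤ 0) :
    IsFloat 2 emin (1 : ℚ) ∧ IsFloat 2 emin (4 : ℚ) ∧ IsFloat 2 emin (8 : ℚ) ∧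
      IsFloat 2 emin (32 : ℚ) ∧ IsFloat 2 emin (12 : ℚ) ∧ IsFloat 2 emin (48 : ℚ) ∧
      IsFloat 2 emin (-4 : ℚ) ∧ IsFloat 2 emin (-3 : ℚ) :=
  ⟨⟨1, 0, by norm_num, he, by norm_num⟩, ⟨1, 2, by norm_num, by omega, by norm_num⟩,
    ⟨1, 3, by norm_num, by omega, by norm_num⟩, ⟨1, 5, by norm_num, by omega, by norm_num⟩,
    ⟨3, 2, by norm_num, by omega, by norm_num⟩, ⟨3, 4, by norm_num, by omega, by norm_num⟩,
    ⟨-1, 2, by norm_num, by omega, by norm_num⟩, ⟨-3, 0, by norm_num, he, by norm_num⟩⟩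

/-- `⟨1, 4, 8, 32⟩` is a nonoverlapping expansion (each component on a grid strictly above the
lower ones). [cite: Shewchuk1997, §2.1 (nonoverlapping)] -/
theorem p2_isExpansion : IsExpansion 1 ([1, 4, 8, 32] : List ℚ) := by
  have b : ∀ (x y : ℚ) (s r : ℤ), y = (r : ℚ) * 2 ^ s → 1 * |x| < (2 : ℚ) ^ s →
      Below 1 x y := fun x y s r h1 h2 => ⟨s, ⟨r, h1⟩, h2⟩
  refine List.Pairwise.cons ?_ (List.Pairwise.cons ?_ (List.Pairwise.cons ?_
    (List.pairwise_singleton _ _)))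
  · intro y hy
    simp only [List.mem_cons, List.not_mem_nil, or_false] at hy
    rcases hy with rfl | rfl | rfl
    · exact b 1 4 2 1 (by norm_num) (by norm_num)
    · exact b 1 8 3 1 (by norm_num) (by norm_num)
    · exact b 1 32 5 1 (by norm_num) (by norm_num)
  · intro y hy
    simp only [List.mem_cons, List.not_mem_nil, or_false] at hy
    rcases hy with rfl | rfl
    · exact b 4 8 3 1 (by norm_num) (by norm_num)
    · exact b 4 32 5 1 (by norm_num) (by norm_num)
  · intro y hy
    simp only [List.mem_cons, List.not_mem_nil, or_false] at hy
    subst hy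
    exact b 8 32 4 2 (by norm_num) (by norm_num)

/-! ### The two passes -/

/-- **First pass** (`p = 2`, round-to-even): `COMPRESS⟨1, 4, 8, 32⟩ = ⟨1, −4, 48⟩`.  Downward:
`(32, 8) ↦ (32, 8)` [the tie, emit `32`], `(8, 4) ↦ (12, 0)` [absorb], `(12, 1) ↦ (12, 1)`
[emit]; upward from `1`: `(12, 1) ↦ (12, 1)` emits `1`, `(32, 12) ↦ (48, −4)` emits `−4`, top
`48`.
[cite: Shewchuk1997, §2.7 p. 332 (COMPRESS), §2.3 Theorem 6] -/
theorem compress_p2_once (he : emin ≤ 0) :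
    compress (roundTiesEven 2 emin) [1, 4, 8, 32] = [1, -4, 48] := by
  have hfl := isRoundNearest_roundTiesEven (p := 2) (emin := emin) (by norm_num)
  obtain ⟨f1, f4, f8, f32, f12, -, -, -⟩ := p2_isFloat he
  have F1 : fastTwoSum (roundTiesEven 2 emin) 32 8 = (32, 8) := by
    rw [f2s_eq' (by norm_num) (s := 32) hfl f32 f8 (by norm_num)
      (by rw [show (32 : ℚ) + 8 = 40 by norm_num]; exact p2_rne_40 he)]
    norm_num
  have F2 : fastTwoSum (roundTiesEven 2 emin) 8 4 = (12, 0) := by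
    rw [f2s_eq' (by norm_num) (s := 12) hfl f8 f4 (by norm_num)
      (by rw [show (8 : ℚ) + 4 = 12 by norm_num]; exact roundTiesEven_eq_self (by norm_num) f12)]
    norm_num
  have F3 : fastTwoSum (roundTiesEven 2 emin) 12 1 = (12, 1) := by
    rw [f2s_eq' (by norm_num) (s := 12) hfl f12 f1 (by norm_num)
      (by rw [show (12 : ℚ) + 1 = 13 by norm_num]; exact p2_rne_13 he)]
    norm_num
  have F4 : fastTwoSum (roundTiesEven 2 emin) 32 12 = (48, -4) := by
    rw [f2s_eq' (by norm_num) (s := 48) hfl f32 f12 (by norm_num)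
      (by rw [show (32 : ℚ) + 12 = 44 by norm_num]; exact p2_rne_44 he)]
    norm_num
  -- downward pass
  have hD : compressDown (roundTiesEven 2 emin) 32 [8, 4, 1] = ([32, 12], 1) := by
    rw [compressDown_cons_of_ne_zero (by rw [F1]; norm_num), F1]
    simp only
    rw [compressDown_cons_of_eq_zero (by rw [F2]), F2]
    simp only
    rw [compressDown_cons_of_ne_zero (by rw [F3]; norm_num), F3]
    simp
  -- upward pass
  have hc : compress (roundTiesEven 2 emin) [1, 4, 8, 32] =
      compressUp (roundTiesEven 2 emin) 1 [12, 32] := by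
    simp only [compress, List.reverse_cons, List.reverse_nil, List.nil_append, List.cons_append,
      hD]
  rw [hc, compressUp_cons_of_ne_zero (by rw [F3]; norm_num), F3]
  simp only
  rw [compressUp_cons_of_ne_zero (by rw [F4]; norm_num), F4]
  simp

/-- **Second pass** (`p = 2`, round-to-even): `COMPRESS⟨1, −4, 48⟩ = ⟨−3, 48⟩`: downward
`(48, −4) ↦ (48, −4)` emits `48`, `(−4, 1) ↦ (−3, 0)` absorbs EXACTLY; upward
`(48, −3) ↦ (48, −3)`.
[cite: Shewchuk1997, §2.7 p. 332 (COMPRESS), §2.3 Theorem 6] -/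
theorem compress_p2_twice (he : emin ≤ 0) :
    compress (roundTiesEven 2 emin) [1, -4, 48] = [-3, 48] := by
  have hfl := isRoundNearest_roundTiesEven (p := 2) (emin := emin) (by norm_num)
  obtain ⟨f1, -, -, -, -, f48, fm4, fm3⟩ := p2_isFloat he
  have F5 : fastTwoSum (roundTiesEven 2 emin) 48 (-4) = (48, -4) := by
    rw [f2s_eq' (by norm_num) (s := 48) hfl f48 fm4 (by norm_num)
      (by rw [show (48 : ℚ) + -4 = 44 by norm_num]; exact p2_rne_44 he)]
    norm_num
  have F6 : fastTwoSum (roundTiesEven 2 emin) (-4) 1 = (-3, 0) := by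
    rw [f2s_eq' (by norm_num) (s := -3) hfl fm4 f1 (by norm_num)
      (by rw [show (-4 : ℚ) + 1 = -3 by norm_num]; exact roundTiesEven_eq_self (by norm_num) fm3)]
    norm_num
  have F7 : fastTwoSum (roundTiesEven 2 emin) 48 (-3) = (48, -3) := by
    rw [f2s_eq' (by norm_num) (s := 48) hfl f48 fm3 (by norm_num)
      (by rw [show (48 : ℚ) + -3 = 45 by norm_num]; exact p2_rne_45 he)]
    norm_num
  have hD : compressDown (roundTiesEven 2 emin) 48 [-4, 1] = ([48], -3) := by
    rw [compressDown_cons_of_ne_zero (by rw [F5]; norm_num), F5]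
    simp only
    rw [compressDown_cons_of_eq_zero (by rw [F6]), F6]
    simp
  have hc : compress (roundTiesEven 2 emin) [1, -4, 48] =
      compressUp (roundTiesEven 2 emin) (-3) [48] := by
    simp only [compress, List.reverse_cons, List.reverse_nil, List.nil_append, List.cons_append,
      hD]
  rw [hc, compressUp_cons_of_ne_zero (by rw [F7]; norm_num), F7]
  simp

/-- **COMPRESS is not idempotent at precision `p = 2`** (round-to-nearest-even, `emin ≤ 0`):
a valid four-component input whose output `⟨1, −4, 48⟩` is shortened to `⟨−3, 48⟩` by a
second pass.  Together with `compress_not_idempotent` (`p ≥ 3`) this covers every precision `p ≥ 2`.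
[cite: Shewchuk1997, Thm 23 p. 331 ("if round-to-even tiebreaking is used …"); §2.7 p. 331
(Priest's renormalisation "compresses optimally")] -/
theorem compress_not_idempotent_prec_two (he : emin ≤ 0) :
    ∃ e : List ℚ, (∀ x ∈ e, IsFloat 2 emin x) ∧ IsExpansion 1 e ∧
      compress (roundTiesEven 2 emin) (compress (roundTiesEven 2 emin) e) ≠
        compress (roundTiesEven 2 emin) e ∧
      (compress (roundTiesEven 2 emin) (compress (roundTiesEven 2 emin) e)).length = 2 ∧
      (compress (roundTiesEven 2 emin) e).length = 3 ∧ e.length = 4 := by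
  obtain ⟨f1, f4, f8, f32, -, -, -, -⟩ := p2_isFloat he
  refine ⟨[1, 4, 8, 32], ?_, p2_isExpansion, ?_, ?_, ?_, rfl⟩
  · intro x hx
    simp only [List.mem_cons, List.not_mem_nil, or_false] at hx
    rcases hx with rfl | rfl | rfl | rfl
    exacts [f1, f4, f8, f32]
  · rw [compress_p2_once he, compress_p2_twice he]; simp
  · rw [compress_p2_once he, compress_p2_twice he]; simp
  · rw [compress_p2_once he]; simp

/-- SANITY CHECK at `emin = 0` (the theorems evaluated; matches the integer model of the printed
algorithm). [cite: Shewchuk1997, §2.7 p. 332] -/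
example : compress (roundTiesEven 2 0) [1, 4, 8, 32] = [1, -4, 48] ∧
    compress (roundTiesEven 2 0) [1, -4, 48] = [-3, 48] :=
  ⟨compress_p2_once le_rfl, compress_p2_twice le_rfl⟩

end Summit.Ventures.CertifiedArithmetic.Expansions
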